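import Literature.MathematicalPhysics.QuantumLattice.FinDimSpectrum
import Literature.LinearAlgebra.Matrix.HermitianEigenvaluePerturbation
import HarnessLib

/-!
# Variational eigenvalue counting, Weyl monotonicity and cluster gaps from block form bounds

Sibling proof file of `Literature/MathematicalPhysics/QuantumLattice/FinDimSpectrum.lean` (where
`Matrix.HasClusterGap` is defined). Finite-dimensional spectral toolkit used in the final step
(§7, "Final Argument") of the Michalakis–Zwolak stability proof (hubbard.S19,
`Literature.MathematicalPhysics.QuantumLattice.michalakis_zwolak`): there the rotated Hamiltonian
`H' = U⁎(H₀ + sV − E_s)U = H₀ + W_s + Δ_s` is block diagonal with respect to the unperturbed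
ground space `P₀`, its quadratic form is within `‖Δ_s‖` of `0` on `P₀` and `≥ (1 − cJ)γ − ‖Δ_s‖`
on `1 − P₀`, and one must conclude that `H₀ + sV` has exactly `m = rank P₀` eigenvalues in a
window of width `2‖Δ_s‖` separated by a gap from the rest (a `Matrix.HasClusterGap`), and that
this property propagates in `s` by small steps (Weyl's perturbation bound). Everything is proved
from Mathlib's spectral theorem for Hermitian matrices (`Matrix.IsHermitian.eigenvectorBasis`;
the diagonalisation lemma `toEuclideanLin_eigenvectorBasis` is reused from
`Literature.LinearAlgebra.Matrix.HermitianEigenvaluePerturbation`).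

Contents (all for a Hermitian matrix `A`, `T = toEuclideanLin A` on `EuclideanSpace 𝕜 n`,
`λᵢ = hA.eigenvalues i`, `uᵢ = hA.eigenvectorBasis i`):

* `re_inner_toEuclideanLin_eq_sum` — `re ⟪x, T x⟫ = Σᵢ λᵢ ‖⟪uᵢ, x⟫‖²`;
* spans `E_S = span {uᵢ | i ∈ S}` of eigenvectors ("`eigSpan`" in lemma names):
  `finrank_eigSpan` (`dim E_S = #S`); on `E_S`
  `re ⟪x, T x⟫ = Σ_{i ∈ S} λᵢ ‖⟪uᵢ, x⟫‖²` and `‖x‖² = Σ_{i ∈ S} ‖⟪uᵢ, x⟫‖²`;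
* **variational counting** (the two halves of Courant–Fischer in counting form): if
  `re ⟪x, T x⟫ ≤ a‖x‖²` on a subspace `K` then `finrank K ≤ #{i | λᵢ ≤ a}`
  (`finrank_le_card_eigenvalues_le`), with the strict and the reversed variants;
* **Weyl monotonicity of the counting functions**: if `re ⟪x, B x⟫ ≤ re ⟪x, A x⟫ + t‖x‖²` for all
  `x` then `#{λᵢ(A) ≤ a} ≤ #{λᵢ(B) ≤ a + t}` and `#{λᵢ(A) < a} ≤ #{λᵢ(B) < a + t}`; the
  hypothesis from `‖A − B‖ ≤ t` (L²-operator norm);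
* **cluster gap from block form bounds** (`hasClusterGap_of_invariant_forms`): `K` an
  `A`-invariant subspace of dimension `m ≥ 1` with `e₁‖x‖² ≤ re⟪x,Ax⟫ ≤ e₂‖x‖²` on `K` and
  `re⟪x,Ax⟫ ≥ e₃‖x‖²` on `Kᗮ`, `2e₂ − e₁ < e₃` ⟹ `A.HasClusterGap m (e₂ − e₁) (e₃ − 2e₂ + e₁)`;
* **bootstrap step** (`sepCount_of_norm_sub_le`): "exactly `m` eigenvalues `≤ e`, all others
  `≥ e + g`" passes from `A` to `B` with `e ↦ e + t`, `g ↦ g − 2t` when `‖A − B‖ ≤ t < g/2`.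

Sources: the counting form of the min–max principle is Reed–Simon IV, Thm XIII.1/XIII.2 and
Bhatia, *Matrix Analysis* (1997) Cor. III.1.2, III.2.6 (Weyl); the use made of it is
Michalakis–Zwolak, CMP **322** (2013) 277 = arXiv:1109.1588, §7 (pp. 15–16 of the arXiv text:
"any state `ψ₁` orthogonal to the `P₀(0)` subspace has energy at least `(1−cJ)γ − ‖Δ_s‖` …
the gap is bounded below by `γ_s ≥ (1−cJ)γ − 2‖Δ_s‖`" and the continuity-in-`s` contradiction
argument). No definitions and no named facts are introduced (theorems only).
-/

noncomputable section

open Matrix Finset Module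
open scoped InnerProductSpace ComplexOrder

namespace Literature.MathematicalPhysics.QuantumLattice

section RCLike

variable {𝕜 : Type*} [RCLike 𝕜] {n : Type*} [Fintype n] [DecidableEq n]

/-- Coefficients of `T x` in the eigenbasis: `⟪uᵢ, T x⟫ = λᵢ ⟪uᵢ, x⟫` (symmetry of `T` and
`T uᵢ = λᵢ uᵢ` with `λᵢ` real). [folklore] -/
theorem inner_eigenvectorBasis_toEuclideanLin {A : Matrix n n 𝕜} (hA : A.IsHermitian)
    (x : EuclideanSpace 𝕜 n) (i : n) :
    ⟪hA.eigenvectorBasis i, toEuclideanLin A x⟫_𝕜 =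
      ((hA.eigenvalues i : ℝ) : 𝕜) * ⟪hA.eigenvectorBasis i, x⟫_𝕜 := by
  have hsym : (toEuclideanLin A).IsSymmetric := isSymmetric_toEuclideanLin_iff.mpr hA
  rw [← hsym (hA.eigenvectorBasis i) x, Literature.LinearAlgebra.Matrix.toEuclideanLin_eigenvectorBasis hA i,
    inner_smul_left, RCLike.conj_ofReal]

/-- **The quadratic form in the eigenbasis**: `⟪x, T x⟫ = Σᵢ λᵢ ‖⟪uᵢ, x⟫‖²` (as an element of
`𝕜`). Parseval (`OrthonormalBasis.sum_inner_mul_inner`) and `⟪uᵢ, T x⟫ = λᵢ ⟪uᵢ, x⟫`.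
[folklore] -/
theorem inner_toEuclideanLin_eq_sum {A : Matrix n n 𝕜} (hA : A.IsHermitian)
    (x : EuclideanSpace 𝕜 n) :
    ⟪x, toEuclideanLin A x⟫_𝕜 =
      ∑ i, ((hA.eigenvalues i * ‖⟪hA.eigenvectorBasis i, x⟫_𝕜‖ ^ 2 : ℝ) : 𝕜) := by
  rw [← hA.eigenvectorBasis.sum_inner_mul_inner x (toEuclideanLin A x)]
  refine sum_congr rfl fun i _ => ?_
  rw [inner_eigenvectorBasis_toEuclideanLin hA x i, ← inner_conj_symm x (hA.eigenvectorBasis i),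
    mul_left_comm, RCLike.conj_mul]
  push_cast
  ring

/-- Real form of `inner_toEuclideanLin_eq_sum`: `re ⟪x, T x⟫ = Σᵢ λᵢ ‖⟪uᵢ, x⟫‖²`. [folklore] -/
theorem re_inner_toEuclideanLin_eq_sum {A : Matrix n n 𝕜} (hA : A.IsHermitian)
    (x : EuclideanSpace 𝕜 n) :
    RCLike.re ⟪x, toEuclideanLin A x⟫_𝕜 =
      ∑ i, hA.eigenvalues i * ‖⟪hA.eigenvectorBasis i, x⟫_𝕜‖ ^ 2 := by
  rw [inner_toEuclideanLin_eq_sum hA x, ← RCLike.ofReal_sum, RCLike.ofReal_re]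

/-- Parseval in the eigenbasis: `‖x‖² = Σᵢ ‖⟪uᵢ, x⟫‖²`
(`OrthonormalBasis.sum_sq_norm_inner_right`). [folklore] -/
theorem norm_sq_eq_sum_eigenvectorBasis {A : Matrix n n 𝕜} (hA : A.IsHermitian)
    (x : EuclideanSpace 𝕜 n) :
    ‖x‖ ^ 2 = ∑ i, ‖⟪hA.eigenvectorBasis i, x⟫_𝕜‖ ^ 2 :=
  (hA.eigenvectorBasis.sum_sq_norm_inner_right x).symm

/-! ### Spans of eigenvectors -/

/-- `dim E_S = #S` (the eigenvectors are orthonormal, hence linearly independent;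
`finrank_span_eq_card`). [folklore] -/
theorem finrank_eigSpan {A : Matrix n n 𝕜} (hA : A.IsHermitian) (S : Finset n) :
    finrank 𝕜 (Submodule.span 𝕜 (Set.range fun i : S => hA.eigenvectorBasis i)) = #S := by
  have hli : LinearIndependent 𝕜 fun i : S => hA.eigenvectorBasis i :=
    hA.eigenvectorBasis.orthonormal.linearIndependent.comp (fun i : S => (i : n))
      Subtype.val_injective
  rw [finrank_span_eq_card hli, Fintype.card_coe]

/-- Vectors of `E_S` have no components along the eigenvectors outside `S`:
`⟪uⱼ, x⟫ = 0` for `x ∈ E_S`, `j ∉ S` (orthonormality, by span induction). [folklore] -/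
theorem inner_eigenvectorBasis_eq_zero_of_mem_eigSpan {A : Matrix n n 𝕜} (hA : A.IsHermitian)
    {S : Finset n} {x : EuclideanSpace 𝕜 n} (hx : x ∈ Submodule.span 𝕜 (Set.range fun i : S => hA.eigenvectorBasis i)) {j : n} (hj : j ∉ S) :
    ⟪hA.eigenvectorBasis j, x⟫_𝕜 = 0 := by
  induction hx using Submodule.span_induction with
  | mem y hy =>
    obtain ⟨i, rfl⟩ := hy
    have hij : j ≠ (i : n) := fun h => hj (h ▸ i.2)
    exact hA.eigenvectorBasis.orthonormal.2 hij
  | zero => exact inner_zero_right _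
  | add y z _ _ hy hz => rw [inner_add_right, hy, hz, add_zero]
  | smul c y _ hy => rw [inner_smul_right, hy, mul_zero]

/-- On `E_S` the quadratic form only sees the eigenvalues in `S`:
`re ⟪x, T x⟫ = Σ_{i ∈ S} λᵢ ‖⟪uᵢ, x⟫‖²` for `x ∈ E_S`. [folklore] -/
theorem re_inner_toEuclideanLin_eq_sum_of_mem_eigSpan {A : Matrix n n 𝕜} (hA : A.IsHermitian)
    {S : Finset n} {x : EuclideanSpace 𝕜 n} (hx : x ∈ Submodule.span 𝕜 (Set.range fun i : S => hA.eigenvectorBasis i)) :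
    RCLike.re ⟪x, toEuclideanLin A x⟫_𝕜 =
      ∑ i ∈ S, hA.eigenvalues i * ‖⟪hA.eigenvectorBasis i, x⟫_𝕜‖ ^ 2 := by
  rw [re_inner_toEuclideanLin_eq_sum hA x, ← sum_subset (subset_univ S)]
  intro i _ hi
  rw [inner_eigenvectorBasis_eq_zero_of_mem_eigSpan hA hx hi, norm_zero]
  ring

/-- On `E_S` Parseval only sees the indices in `S`: `‖x‖² = Σ_{i ∈ S} ‖⟪uᵢ, x⟫‖²` for
`x ∈ E_S`. [folklore] -/
theorem norm_sq_eq_sum_of_mem_eigSpan {A : Matrix n n 𝕜} (hA : A.IsHermitian)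
    {S : Finset n} {x : EuclideanSpace 𝕜 n} (hx : x ∈ Submodule.span 𝕜 (Set.range fun i : S => hA.eigenvectorBasis i)) :
    ‖x‖ ^ 2 = ∑ i ∈ S, ‖⟪hA.eigenvectorBasis i, x⟫_𝕜‖ ^ 2 := by
  rw [norm_sq_eq_sum_eigenvectorBasis hA x, ← sum_subset (subset_univ S)]
  intro i _ hi
  rw [inner_eigenvectorBasis_eq_zero_of_mem_eigSpan hA hx hi, norm_zero]
  ring

/-- Lower form bound on a span of eigenvectors: if `a ≤ λᵢ` for all `i ∈ S` then
`a‖x‖² ≤ re ⟪x, T x⟫` on `E_S`. [folklore] -/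
theorem mul_norm_sq_le_re_inner_of_mem_eigSpan {A : Matrix n n 𝕜} (hA : A.IsHermitian)
    {S : Finset n} {a : ℝ} (ha : ∀ i ∈ S, a ≤ hA.eigenvalues i) {x : EuclideanSpace 𝕜 n}
    (hx : x ∈ Submodule.span 𝕜 (Set.range fun i : S => hA.eigenvectorBasis i)) :
    a * ‖x‖ ^ 2 ≤ RCLike.re ⟪x, toEuclideanLin A x⟫_𝕜 := by
  rw [re_inner_toEuclideanLin_eq_sum_of_mem_eigSpan hA hx, norm_sq_eq_sum_of_mem_eigSpan hA hx,
    mul_sum]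
  exact sum_le_sum fun i hi => mul_le_mul_of_nonneg_right (ha i hi) (sq_nonneg _)

/-- Upper form bound on a span of eigenvectors: if `λᵢ ≤ a` for all `i ∈ S` then
`re ⟪x, T x⟫ ≤ a‖x‖²` on `E_S`. [folklore] -/
theorem re_inner_le_mul_norm_sq_of_mem_eigSpan {A : Matrix n n 𝕜} (hA : A.IsHermitian)
    {S : Finset n} {a : ℝ} (ha : ∀ i ∈ S, hA.eigenvalues i ≤ a) {x : EuclideanSpace 𝕜 n}
    (hx : x ∈ Submodule.span 𝕜 (Set.range fun i : S => hA.eigenvectorBasis i)) :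
    RCLike.re ⟪x, toEuclideanLin A x⟫_𝕜 ≤ a * ‖x‖ ^ 2 := by
  rw [re_inner_toEuclideanLin_eq_sum_of_mem_eigSpan hA hx, norm_sq_eq_sum_of_mem_eigSpan hA hx,
    mul_sum]
  exact sum_le_sum fun i hi => mul_le_mul_of_nonneg_right (ha i hi) (sq_nonneg _)

/-- Strict lower form bound on a span of eigenvectors: if `a < λᵢ` for all `i ∈ S` then
`a‖x‖² < re ⟪x, T x⟫` for every non-zero `x ∈ E_S`. [folklore] -/
theorem mul_norm_sq_lt_re_inner_of_mem_eigSpan {A : Matrix n n 𝕜} (hA : A.IsHermitian)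
    {S : Finset n} {a : ℝ} (ha : ∀ i ∈ S, a < hA.eigenvalues i) {x : EuclideanSpace 𝕜 n}
    (hx : x ∈ Submodule.span 𝕜 (Set.range fun i : S => hA.eigenvectorBasis i)) (hx0 : x ≠ 0) :
    a * ‖x‖ ^ 2 < RCLike.re ⟪x, toEuclideanLin A x⟫_𝕜 := by
  have hnorm := norm_sq_eq_sum_of_mem_eigSpan hA hx
  rw [re_inner_toEuclideanLin_eq_sum_of_mem_eigSpan hA hx, hnorm, mul_sum]
  -- some coefficient is non-zero
  have hpos : 0 < ∑ i ∈ S, ‖⟪hA.eigenvectorBasis i, x⟫_𝕜‖ ^ 2 := by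
    rw [← hnorm]
    exact pow_pos (norm_pos_iff.mpr hx0) 2
  obtain ⟨j, hjS, hj⟩ := (sum_pos_iff_of_nonneg fun i _ => sq_nonneg _).mp hpos
  exact sum_lt_sum (fun i hi => mul_le_mul_of_nonneg_right (ha i hi).le (sq_nonneg _))
    ⟨j, hjS, mul_lt_mul_of_pos_right (ha j hjS) hj⟩

/-- Strict upper form bound on a span of eigenvectors: if `λᵢ < a` for all `i ∈ S` then
`re ⟪x, T x⟫ < a‖x‖²` for every non-zero `x ∈ E_S`. [folklore] -/
theorem re_inner_lt_mul_norm_sq_of_mem_eigSpan {A : Matrix n n 𝕜} (hA : A.IsHermitian)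
    {S : Finset n} {a : ℝ} (ha : ∀ i ∈ S, hA.eigenvalues i < a) {x : EuclideanSpace 𝕜 n}
    (hx : x ∈ Submodule.span 𝕜 (Set.range fun i : S => hA.eigenvectorBasis i)) (hx0 : x ≠ 0) :
    RCLike.re ⟪x, toEuclideanLin A x⟫_𝕜 < a * ‖x‖ ^ 2 := by
  have hnorm := norm_sq_eq_sum_of_mem_eigSpan hA hx
  rw [re_inner_toEuclideanLin_eq_sum_of_mem_eigSpan hA hx, hnorm, mul_sum]
  have hpos : 0 < ∑ i ∈ S, ‖⟪hA.eigenvectorBasis i, x⟫_𝕜‖ ^ 2 := by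
    rw [← hnorm]
    exact pow_pos (norm_pos_iff.mpr hx0) 2
  obtain ⟨j, hjS, hj⟩ := (sum_pos_iff_of_nonneg fun i _ => sq_nonneg _).mp hpos
  exact sum_lt_sum (fun i hi => mul_le_mul_of_nonneg_right (ha i hi).le (sq_nonneg _))
    ⟨j, hjS, mul_lt_mul_of_pos_right (ha j hjS) hj⟩

/-! ### Variational counting (Courant–Fischer in counting form) -/

/-- **Dimension count.** A subspace `K` meeting the span `E_S` of `#S` eigenvectors trivially
has `dim K + #S ≤ dim = card n` (`dim (K ⊔ E_S) + dim (K ⊓ E_S) = dim K + dim E_S`).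
Reed–Simon IV, proof of Thm XIII.1. [folklore] -/
theorem finrank_add_card_le_of_inf_eigSpan_eq_bot {A : Matrix n n 𝕜} (hA : A.IsHermitian)
    (K : Submodule 𝕜 (EuclideanSpace 𝕜 n)) (S : Finset n) (h : K ⊓ Submodule.span 𝕜 (Set.range fun i : S => hA.eigenvectorBasis i) = ⊥) :
    finrank 𝕜 K + #S ≤ Fintype.card n := by
  have h1 := Submodule.finrank_sup_add_finrank_inf_eq K (Submodule.span 𝕜 (Set.range fun i : S => hA.eigenvectorBasis i))
  rw [h, finrank_bot, add_zero, finrank_eigSpan] at h1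
  rw [← h1, ← finrank_euclideanSpace (𝕜 := 𝕜) (ι := n)]
  exact Submodule.finrank_le _

/-- **Variational counting, upper form bound.** If `re ⟪x, T x⟫ ≤ a‖x‖²` on the subspace `K`,
then `dim K ≤ #{i | λᵢ ≤ a}`: `K` meets the span of the eigenvectors with `λᵢ > a` (where the
form is `> a‖x‖²`) only in `0`. Reed–Simon IV Thm XIII.1 (min–max), counting form; Bhatia,
*Matrix Analysis*, Cor. III.1.2. [folklore] -/
theorem finrank_le_card_eigenvalues_le {A : Matrix n n 𝕜} (hA : A.IsHermitian)
    (K : Submodule 𝕜 (EuclideanSpace 𝕜 n)) {a : ℝ}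
    (hK : ∀ x ∈ K, RCLike.re ⟪x, toEuclideanLin A x⟫_𝕜 ≤ a * ‖x‖ ^ 2) :
    finrank 𝕜 K ≤ #{i | hA.eigenvalues i ≤ a} := by
  set S : Finset n := {i | a < hA.eigenvalues i} with hS
  have hdisj : K ⊓ Submodule.span 𝕜 (Set.range fun i : S => hA.eigenvectorBasis i) = ⊥ := by
    rw [Submodule.eq_bot_iff]
    intro x hx
    by_contra hx0
    have h1 := hK x hx.1
    have h2 := mul_norm_sq_lt_re_inner_of_mem_eigSpan hA (S := S)
      (fun i hi => by simpa [hS] using hi) hx.2 hx0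
    exact absurd (h2.trans_le h1) (lt_irrefl _)
  have h := finrank_add_card_le_of_inf_eigSpan_eq_bot hA K S hdisj
  have hcard : #S + #{i | hA.eigenvalues i ≤ a} = Fintype.card n := by
    have hc := card_filter_add_card_filter_not (s := (univ : Finset n)) (fun i => a < hA.eigenvalues i)
    simp only [not_lt, card_univ] at hc
    simpa [hS] using hc
  omega

/-- **Variational counting, strict upper form bound.** If `re ⟪x, T x⟫ < a‖x‖²` for every
non-zero `x ∈ K`, then `dim K ≤ #{i | λᵢ < a}`. [folklore] -/
theorem finrank_le_card_eigenvalues_lt {A : Matrix n n 𝕜} (hA : A.IsHermitian)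
    (K : Submodule 𝕜 (EuclideanSpace 𝕜 n)) {a : ℝ}
    (hK : ∀ x ∈ K, x ≠ 0 → RCLike.re ⟪x, toEuclideanLin A x⟫_𝕜 < a * ‖x‖ ^ 2) :
    finrank 𝕜 K ≤ #{i | hA.eigenvalues i < a} := by
  set S : Finset n := {i | a ≤ hA.eigenvalues i} with hS
  have hdisj : K ⊓ Submodule.span 𝕜 (Set.range fun i : S => hA.eigenvectorBasis i) = ⊥ := by
    rw [Submodule.eq_bot_iff]
    intro x hx
    by_contra hx0
    have h1 := hK x hx.1 hx0
    have h2 := mul_norm_sq_le_re_inner_of_mem_eigSpan hA (S := S)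
      (fun i hi => by simpa [hS] using hi) hx.2
    exact absurd (h1.trans_le h2) (lt_irrefl _)
  have h := finrank_add_card_le_of_inf_eigSpan_eq_bot hA K S hdisj
  have hcard : #S + #{i | hA.eigenvalues i < a} = Fintype.card n := by
    have hc := card_filter_add_card_filter_not (s := (univ : Finset n)) (fun i => a ≤ hA.eigenvalues i)
    simp only [not_le, card_univ] at hc
    simpa [hS] using hc
  omega

/-- **Variational counting, lower form bound.** If `a‖x‖² ≤ re ⟪x, T x⟫` on `K`, then
`dim K ≤ #{i | a ≤ λᵢ}`. [folklore] -/
theorem finrank_le_card_le_eigenvalues {A : Matrix n n 𝕜} (hA : A.IsHermitian)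
    (K : Submodule 𝕜 (EuclideanSpace 𝕜 n)) {a : ℝ}
    (hK : ∀ x ∈ K, a * ‖x‖ ^ 2 ≤ RCLike.re ⟪x, toEuclideanLin A x⟫_𝕜) :
    finrank 𝕜 K ≤ #{i | a ≤ hA.eigenvalues i} := by
  set S : Finset n := {i | hA.eigenvalues i < a} with hS
  have hdisj : K ⊓ Submodule.span 𝕜 (Set.range fun i : S => hA.eigenvectorBasis i) = ⊥ := by
    rw [Submodule.eq_bot_iff]
    intro x hx
    by_contra hx0
    have h1 := hK x hx.1
    have h2 := re_inner_lt_mul_norm_sq_of_mem_eigSpan hA (S := S)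
      (fun i hi => by simpa [hS] using hi) hx.2 hx0
    exact absurd (h1.trans_lt h2) (lt_irrefl _)
  have h := finrank_add_card_le_of_inf_eigSpan_eq_bot hA K S hdisj
  have hcard : #S + #{i | a ≤ hA.eigenvalues i} = Fintype.card n := by
    have hc := card_filter_add_card_filter_not (s := (univ : Finset n)) (fun i => hA.eigenvalues i < a)
    simp only [not_lt, card_univ] at hc
    simpa [hS] using hc
  omega

/-- **Variational counting, strict lower form bound.** If `a‖x‖² < re ⟪x, T x⟫` for every
non-zero `x ∈ K`, then `dim K ≤ #{i | a < λᵢ}`. [folklore] -/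
theorem finrank_le_card_lt_eigenvalues {A : Matrix n n 𝕜} (hA : A.IsHermitian)
    (K : Submodule 𝕜 (EuclideanSpace 𝕜 n)) {a : ℝ}
    (hK : ∀ x ∈ K, x ≠ 0 → a * ‖x‖ ^ 2 < RCLike.re ⟪x, toEuclideanLin A x⟫_𝕜) :
    finrank 𝕜 K ≤ #{i | a < hA.eigenvalues i} := by
  set S : Finset n := {i | hA.eigenvalues i ≤ a} with hS
  have hdisj : K ⊓ Submodule.span 𝕜 (Set.range fun i : S => hA.eigenvectorBasis i) = ⊥ := by
    rw [Submodule.eq_bot_iff]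
    intro x hx
    by_contra hx0
    have h1 := hK x hx.1 hx0
    have h2 := re_inner_le_mul_norm_sq_of_mem_eigSpan hA (S := S)
      (fun i hi => by simpa [hS] using hi) hx.2
    exact absurd (h1.trans_le h2) (lt_irrefl _)
  have h := finrank_add_card_le_of_inf_eigSpan_eq_bot hA K S hdisj
  have hcard : #S + #{i | a < hA.eigenvalues i} = Fintype.card n := by
    have hc := card_filter_add_card_filter_not (s := (univ : Finset n)) (fun i => hA.eigenvalues i ≤ a)
    simp only [not_le, card_univ] at hc
    simpa [hS] using hc
  omega

/-! ### Weyl monotonicity of the eigenvalue counting functions -/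

/-- **Weyl monotonicity (non-strict count).** If `re ⟪x, B x⟫ ≤ re ⟪x, A x⟫ + t‖x‖²` for all
`x`, then `#{i | λᵢ(A) ≤ a} ≤ #{i | λᵢ(B) ≤ a + t}`: on the span of the `A`-eigenvectors with
`λᵢ(A) ≤ a` (dimension `#{λᵢ(A) ≤ a}`) the form of `B` is `≤ (a + t)‖x‖²`. Bhatia, *Matrix
Analysis*, Cor. III.2.6 (Weyl's monotonicity/perturbation theorem), counting form. [folklore] -/
theorem card_eigenvalues_le_le_card_of_forms {A B : Matrix n n 𝕜} (hA : A.IsHermitian)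
    (hB : B.IsHermitian) {t : ℝ}
    (hAB : ∀ x : EuclideanSpace 𝕜 n, RCLike.re ⟪x, toEuclideanLin B x⟫_𝕜 ≤
      RCLike.re ⟪x, toEuclideanLin A x⟫_𝕜 + t * ‖x‖ ^ 2) (a : ℝ) :
    #{i | hA.eigenvalues i ≤ a} ≤ #{i | hB.eigenvalues i ≤ a + t} := by
  set S : Finset n := {i | hA.eigenvalues i ≤ a} with hS
  rw [← finrank_eigSpan hA S]
  refine finrank_le_card_eigenvalues_le hB (Submodule.span 𝕜 (Set.range fun i : S => hA.eigenvectorBasis i)) fun x hx => ?_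
  have h1 := re_inner_le_mul_norm_sq_of_mem_eigSpan hA (S := S) (a := a)
    (fun i hi => by simpa [hS] using hi) hx
  have h2 := hAB x
  linarith

/-- **Weyl monotonicity (strict count).** If `re ⟪x, B x⟫ ≤ re ⟪x, A x⟫ + t‖x‖²` for all `x`,
then `#{i | λᵢ(A) < a} ≤ #{i | λᵢ(B) < a + t}`. Bhatia, *Matrix Analysis*, Cor. III.2.6,
counting form. [folklore] -/
theorem card_eigenvalues_lt_le_card_of_forms {A B : Matrix n n 𝕜} (hA : A.IsHermitian)
    (hB : B.IsHermitian) {t : ℝ}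
    (hAB : ∀ x : EuclideanSpace 𝕜 n, RCLike.re ⟪x, toEuclideanLin B x⟫_𝕜 ≤
      RCLike.re ⟪x, toEuclideanLin A x⟫_𝕜 + t * ‖x‖ ^ 2) (a : ℝ) :
    #{i | hA.eigenvalues i < a} ≤ #{i | hB.eigenvalues i < a + t} := by
  set S : Finset n := {i | hA.eigenvalues i < a} with hS
  rw [← finrank_eigSpan hA S]
  refine finrank_le_card_eigenvalues_lt hB (Submodule.span 𝕜 (Set.range fun i : S => hA.eigenvectorBasis i)) fun x hx hx0 => ?_
  have h1 := re_inner_lt_mul_norm_sq_of_mem_eigSpan hA (S := S) (a := a)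
    (fun i hi => by simpa [hS] using hi) hx hx0
  have h2 := hAB x
  linarith

/-- The quadratic form of a matrix is bounded by its L²-operator norm:
`|re ⟪x, E x⟫| ≤ ‖E‖ ‖x‖²` (Cauchy–Schwarz and `‖E x‖ ≤ ‖E‖ ‖x‖`). [folklore] -/
theorem abs_re_inner_toEuclideanLin_le (E : Matrix n n 𝕜) (x : EuclideanSpace 𝕜 n) :
    |RCLike.re ⟪x, toEuclideanLin E x⟫_𝕜| ≤
      ‖toEuclideanCLM (n := n) (𝕜 := 𝕜) E‖ * ‖x‖ ^ 2 := by
  calc |RCLike.re ⟪x, toEuclideanLin E x⟫_𝕜| ≤ ‖⟪x, toEuclideanLin E x⟫_𝕜‖ :=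
        RCLike.abs_re_le_norm _
    _ ≤ ‖x‖ * ‖toEuclideanLin E x‖ := norm_inner_le_norm _ _
    _ ≤ ‖x‖ * (‖toEuclideanCLM (n := n) (𝕜 := 𝕜) E‖ * ‖x‖) := by
        refine mul_le_mul_of_nonneg_left ?_ (norm_nonneg _)
        exact (toEuclideanCLM (n := n) (𝕜 := 𝕜) E).le_opNorm x
    _ = ‖toEuclideanCLM (n := n) (𝕜 := 𝕜) E‖ * ‖x‖ ^ 2 := by ring

/-- Form comparison from an operator-norm bound: `‖A − B‖ ≤ t` (L²-operator norm, written
through `toEuclideanCLM`) gives `re ⟪x, B x⟫ ≤ re ⟪x, A x⟫ + t‖x‖²`. [folklore] -/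
theorem re_inner_le_re_inner_add_of_norm_sub_le {A B : Matrix n n 𝕜} {t : ℝ}
    (h : ‖toEuclideanCLM (n := n) (𝕜 := 𝕜) (A - B)‖ ≤ t) (x : EuclideanSpace 𝕜 n) :
    RCLike.re ⟪x, toEuclideanLin B x⟫_𝕜 ≤ RCLike.re ⟪x, toEuclideanLin A x⟫_𝕜 + t * ‖x‖ ^ 2 := by
  have h1 := abs_re_inner_toEuclideanLin_le (B - A) x
  have h2 : toEuclideanLin (B - A) x = toEuclideanLin B x - toEuclideanLin A x := by
    rw [map_sub, LinearMap.sub_apply]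
  rw [h2, inner_sub_right, map_sub] at h1
  have h3 : ‖toEuclideanCLM (n := n) (𝕜 := 𝕜) (B - A)‖ =
      ‖toEuclideanCLM (n := n) (𝕜 := 𝕜) (A - B)‖ := by
    rw [← norm_neg, ← map_neg, neg_sub]
  rw [h3] at h1
  have h4 := (abs_le.mp h1).2
  nlinarith [sq_nonneg ‖x‖, mul_le_mul_of_nonneg_right h (sq_nonneg ‖x‖)]

/-! ### The bootstrap step: a separated low cluster is stable under small perturbations -/

/-- **Stability of a separated eigenvalue cluster (form version).** Suppose `A` has exactly `m`
eigenvalues `≤ e` and all its other eigenvalues are `≥ e + g`, and `B` is `t`-close to `A` in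
quadratic form in both directions with `2t < g`. Then `B` has exactly `m` eigenvalues `≤ e + t`
and all its other eigenvalues are `≥ e + g − t`. (Both counts are squeezed between
`#{λᵢ(A) ≤ e} = m` and `#{λᵢ(A) < e + g} = m` by Weyl monotonicity.) This is the elementary
step behind the continuity argument of Michalakis–Zwolak, arXiv:1109.1588 §7 ("a contradiction
of the continuity of `γ_s` for finite `L`"); Bravyi–Hastings–Michalakis (2010) §7. [folklore] -/
theorem sepCount_of_forms {A B : Matrix n n 𝕜} (hA : A.IsHermitian) (hB : B.IsHermitian)
    {t e g : ℝ} {m : ℕ}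
    (hAB : ∀ x : EuclideanSpace 𝕜 n, RCLike.re ⟪x, toEuclideanLin B x⟫_𝕜 ≤
      RCLike.re ⟪x, toEuclideanLin A x⟫_𝕜 + t * ‖x‖ ^ 2)
    (hBA : ∀ x : EuclideanSpace 𝕜 n, RCLike.re ⟪x, toEuclideanLin A x⟫_𝕜 ≤
      RCLike.re ⟪x, toEuclideanLin B x⟫_𝕜 + t * ‖x‖ ^ 2)
    (hcount : #{i | hA.eigenvalues i ≤ e} = m)
    (hsep : ∀ i, hA.eigenvalues i ≤ e ∨ e + g ≤ hA.eigenvalues i) (ht : 2 * t < g) :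
    #{i | hB.eigenvalues i ≤ e + t} = m ∧
      ∀ i, hB.eigenvalues i ≤ e + t ∨ e + g - t ≤ hB.eigenvalues i := by
  -- lower count
  have h1 : m ≤ #{i | hB.eigenvalues i ≤ e + t} :=
    hcount ▸ card_eigenvalues_le_le_card_of_forms hA hB hAB e
  -- upper count
  have h2 : #{i | hB.eigenvalues i < e + g - t} ≤ m := by
    refine (card_eigenvalues_lt_le_card_of_forms hB hA hBA (e + g - t)).trans ?_
    rw [sub_add_cancel, ← hcount]
    refine card_le_card fun i hi => ?_
    simp only [mem_filter, mem_univ, true_and] at hi ⊢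
    rcases hsep i with h | h
    · exact h
    · exact absurd (h.trans_lt hi) (lt_irrefl _)
  -- the two sets are nested, hence equal
  have hsub : ({i | hB.eigenvalues i ≤ e + t} : Finset n) ⊆
      ({i | hB.eigenvalues i < e + g - t} : Finset n) :=
    fun i hi => by
      simp only [mem_filter, mem_univ, true_and] at hi ⊢
      linarith
  have hle := card_le_card hsub
  have heq : ({i | hB.eigenvalues i ≤ e + t} : Finset n) =
      ({i | hB.eigenvalues i < e + g - t} : Finset n) :=
    eq_of_subset_of_card_le hsub (by omega)
  refine ⟨by omega, fun i => ?_⟩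
  by_cases hi : hB.eigenvalues i ≤ e + t
  · exact Or.inl hi
  · right
    have hi' : i ∉ ({i | hB.eigenvalues i < e + g - t} : Finset n) := by
      rw [← heq]
      simpa using hi
    simpa using hi'

/-- **Stability of a separated eigenvalue cluster (norm version).** If `‖A − B‖ ≤ t`
(L²-operator norm) with `2t < g`, and `A` has exactly `m` eigenvalues `≤ e` and all others
`≥ e + g`, then `B` has exactly `m` eigenvalues `≤ e + t` and all others `≥ e + g − t`.
Weyl's perturbation theorem (Bhatia, *Matrix Analysis*, Cor. III.2.6) in the form used by
Michalakis–Zwolak, arXiv:1109.1588 §7. [folklore] -/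
theorem sepCount_of_norm_sub_le {A B : Matrix n n 𝕜} (hA : A.IsHermitian) (hB : B.IsHermitian)
    {t e g : ℝ} {m : ℕ} (hnorm : ‖toEuclideanCLM (n := n) (𝕜 := 𝕜) (A - B)‖ ≤ t)
    (hcount : #{i | hA.eigenvalues i ≤ e} = m)
    (hsep : ∀ i, hA.eigenvalues i ≤ e ∨ e + g ≤ hA.eigenvalues i) (ht : 2 * t < g) :
    #{i | hB.eigenvalues i ≤ e + t} = m ∧
      ∀ i, hB.eigenvalues i ≤ e + t ∨ e + g - t ≤ hB.eigenvalues i := by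
  have hnorm' : ‖toEuclideanCLM (n := n) (𝕜 := 𝕜) (B - A)‖ ≤ t := by
    rwa [← norm_neg, ← map_neg, neg_sub]
  exact sepCount_of_forms hA hB (re_inner_le_re_inner_add_of_norm_sub_le hnorm)
    (re_inner_le_re_inner_add_of_norm_sub_le hnorm') hcount hsep ht

end RCLike

/-! ### Cluster gaps from block form bounds -/

section Complex

variable {n : Type*} [Fintype n] [DecidableEq n]

/-- An invariant subspace of a Hermitian operator has an invariant orthogonal complement.
[folklore] -/
theorem toEuclideanLin_mem_orthogonal_of_invariant {𝕜 : Type*} [RCLike 𝕜] {A : Matrix n n 𝕜}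
    (hA : A.IsHermitian) (K : Submodule 𝕜 (EuclideanSpace 𝕜 n))
    (hinv : ∀ x ∈ K, toEuclideanLin A x ∈ K) {z : EuclideanSpace 𝕜 n} (hz : z ∈ Kᗮ) :
    toEuclideanLin A z ∈ Kᗮ := by
  rw [Submodule.mem_orthogonal]
  intro y hy
  have hsym : (toEuclideanLin A).IsSymmetric := isSymmetric_toEuclideanLin_iff.mpr hA
  rw [← hsym y z]
  exact Submodule.inner_right_of_mem_orthogonal (hinv y hy) hz

/-- **Block form bounds give a global lower form bound.** If `K` is invariant under the Hermitian
`A`, `re ⟪y, A y⟫ ≥ e₁‖y‖²` on `K`, `re ⟪z, A z⟫ ≥ e₃‖z‖²` on `Kᗮ` and `e₁ ≤ e₃`, then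
`re ⟪x, A x⟫ ≥ e₁‖x‖²` for all `x` (the cross terms vanish). [folklore] -/
theorem mul_norm_sq_le_re_inner_of_invariant {𝕜 : Type*} [RCLike 𝕜] {A : Matrix n n 𝕜}
    (hA : A.IsHermitian) (K : Submodule 𝕜 (EuclideanSpace 𝕜 n))
    (hinv : ∀ x ∈ K, toEuclideanLin A x ∈ K) {e₁ e₃ : ℝ} (h13 : e₁ ≤ e₃)
    (hlow : ∀ x ∈ K, e₁ * ‖x‖ ^ 2 ≤ RCLike.re ⟪x, toEuclideanLin A x⟫_𝕜)
    (hhigh : ∀ x ∈ Kᗮ, e₃ * ‖x‖ ^ 2 ≤ RCLike.re ⟪x, toEuclideanLin A x⟫_𝕜)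
    (x : EuclideanSpace 𝕜 n) :
    e₁ * ‖x‖ ^ 2 ≤ RCLike.re ⟪x, toEuclideanLin A x⟫_𝕜 := by
  set y : EuclideanSpace 𝕜 n := K.starProjection x with hy
  set z : EuclideanSpace 𝕜 n := x - y with hz
  have hyK : y ∈ K := K.starProjection_apply_mem x
  have hzK : z ∈ Kᗮ := K.sub_starProjection_mem_orthogonal x
  have hx : x = y + z := by rw [hz, add_sub_cancel]
  have hAy : toEuclideanLin A y ∈ K := hinv y hyK
  have hAz : toEuclideanLin A z ∈ Kᗮ := toEuclideanLin_mem_orthogonal_of_invariant hA K hinv hzK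
  have hform : ⟪x, toEuclideanLin A x⟫_𝕜 = ⟪y, toEuclideanLin A y⟫_𝕜 + ⟪z, toEuclideanLin A z⟫_𝕜 := by
    conv_lhs => rw [hx]
    rw [map_add, inner_add_left, inner_add_right, inner_add_right,
      Submodule.inner_right_of_mem_orthogonal hyK hAz,
      Submodule.inner_left_of_mem_orthogonal hAy hzK]
    ring
  have hpyth : ‖x‖ ^ 2 = ‖y‖ ^ 2 + ‖z‖ ^ 2 := by
    conv_lhs => rw [hx]
    have := norm_add_sq_eq_norm_sq_add_norm_sq_of_inner_eq_zero y z
      (Submodule.inner_right_of_mem_orthogonal hyK hzK)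
    rw [← sq, ← sq, ← sq] at this
    -- `this : ‖y + z‖ * ‖y + z‖ = ...` shape may differ; normalise
    nlinarith [this]
  rw [hform, map_add, hpyth, mul_add]
  have h1 := hlow y hyK
  have h2 := hhigh z hzK
  nlinarith [sq_nonneg ‖z‖]

/-- Each eigenvalue is a value of the quadratic form: `λᵢ = re ⟪uᵢ, A uᵢ⟫`. [folklore] -/
theorem eigenvalues_eq_re_inner {𝕜 : Type*} [RCLike 𝕜] {A : Matrix n n 𝕜} (hA : A.IsHermitian)
    (i : n) :
    hA.eigenvalues i =
      RCLike.re ⟪hA.eigenvectorBasis i, toEuclideanLin A (hA.eigenvectorBasis i)⟫_𝕜 := by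
  rw [inner_eigenvectorBasis_toEuclideanLin hA, inner_self_eq_norm_sq_to_K,
    hA.eigenvectorBasis.orthonormal.1 i]
  simp

/-- **Cluster gap from block form bounds** (the spectral conclusion of Michalakis–Zwolak §7).
Let `A` be Hermitian and `K` an `A`-invariant subspace of dimension `m ≥ 1` such that
`e₁‖x‖² ≤ re ⟪x, A x⟫ ≤ e₂‖x‖²` on `K` and `re ⟪x, A x⟫ ≥ e₃‖x‖²` on `Kᗮ`, where
`2e₂ − e₁ < e₃`. Then `A` has exactly `m` eigenvalues in the window `[E₀, E₀ + (e₂ − e₁)]`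
above its least eigenvalue `E₀ ∈ [e₁, e₂]`, and every other eigenvalue is `≥ e₃`, in particular
`≥ E₀ + (e₂ − e₁) + (e₃ − 2e₂ + e₁)`: `A.HasClusterGap m (e₂ − e₁) (e₃ − 2e₂ + e₁)`.
Proof: variational counting gives `m ≤ #{λ ≤ e₂}` (form `≤ e₂` on `K`) and
`#{λ < e₃} ≤ m` (form `≥ e₃` on `Kᗮ`, `dim Kᗮ = card n − m`), so every threshold in
`[e₂, e₃)` separates exactly `m` eigenvalues; `E₀ ≥ e₁` by the global lower form bound and
`E₀ ≤ e₂` because some eigenvalue is `≤ e₂`. Michalakis–Zwolak, arXiv:1109.1588 §7 (p. 16: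
states in `P₀` have energy within `‖Δ_s‖` of `E_s`, states orthogonal to `P₀` have energy
`≥ E_s + (1 − cJ)γ − ‖Δ_s‖`, "the gap is bounded below by `(1−cJ)γ − 2‖Δ_s‖`").
[cite: MichalakisZwolakCMP2013, §7 (arXiv:1109.1588 pp. 15–16)] -/
theorem hasClusterGap_of_invariant_forms {A : Matrix n n ℂ} (hA : A.IsHermitian)
    (K : Submodule ℂ (EuclideanSpace ℂ n)) (hinv : ∀ x ∈ K, toEuclideanLin A x ∈ K)
    {m : ℕ} (hm : 0 < m) (hK : finrank ℂ K = m) {e₁ e₂ e₃ : ℝ} (h₁₂ : e₁ ≤ e₂)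
    (h₂₃ : 2 * e₂ - e₁ < e₃)
    (hlow₁ : ∀ x ∈ K, e₁ * ‖x‖ ^ 2 ≤ RCLike.re ⟪x, toEuclideanLin A x⟫_ℂ)
    (hlow₂ : ∀ x ∈ K, RCLike.re ⟪x, toEuclideanLin A x⟫_ℂ ≤ e₂ * ‖x‖ ^ 2)
    (hhigh : ∀ x ∈ Kᗮ, e₃ * ‖x‖ ^ 2 ≤ RCLike.re ⟪x, toEuclideanLin A x⟫_ℂ) :
    A.HasClusterGap m (e₂ - e₁) (e₃ - 2 * e₂ + e₁) := by
  have h13 : e₁ ≤ e₃ := by linarith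
  -- global lower bound and the least eigenvalue
  have hglob := mul_norm_sq_le_re_inner_of_invariant hA K hinv h13 hlow₁ hhigh
  have hlam : ∀ i, e₁ ≤ hA.eigenvalues i := fun i => by
    have := hglob (hA.eigenvectorBasis i)
    rw [hA.eigenvectorBasis.orthonormal.1 i, one_pow, mul_one, ← eigenvalues_eq_re_inner hA i]
      at this
    exact this
  set E₀ : ℝ := ⨅ j, hA.eigenvalues j with hE₀
  -- counting below `e₂` and below `e₃`
  have hN₁ : m ≤ #{i | hA.eigenvalues i ≤ e₂} :=
    hK ▸ finrank_le_card_eigenvalues_le hA K hlow₂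
  have hN₂ : #{i | hA.eigenvalues i < e₃} ≤ m := by
    have h1 := finrank_le_card_le_eigenvalues hA Kᗮ hhigh
    have h2 := Submodule.finrank_add_finrank_orthogonal K
    rw [finrank_euclideanSpace, hK] at h2
    have h3 := card_filter_add_card_filter_not (s := (univ : Finset n))
      (fun i => e₃ ≤ hA.eigenvalues i)
    simp only [not_le, card_univ] at h3
    omega
  -- nonempty index type, `E₀ ≤ e₂`
  have hne : ({i | hA.eigenvalues i ≤ e₂} : Finset n).Nonempty := by
    rw [← Finset.card_pos]
    omega
  obtain ⟨i₀, hi₀⟩ := hne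
  simp only [mem_filter, mem_univ, true_and] at hi₀
  haveI : Nonempty n := ⟨i₀⟩
  have hbdd : BddBelow (Set.range hA.eigenvalues) := (Set.finite_range _).bddBelow
  have hE₀le : E₀ ≤ e₂ := (ciInf_le hbdd i₀).trans hi₀
  have hE₀ge : e₁ ≤ E₀ := le_ciInf hlam
  -- the window threshold
  set θ : ℝ := E₀ + (e₂ - e₁) with hθ
  have hθ₂ : e₂ ≤ θ := by rw [hθ]; linarith
  have hθ₃ : θ < e₃ := by rw [hθ]; linarith
  have hsub₁ : ({i | hA.eigenvalues i ≤ e₂} : Finset n) ⊆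
      ({i | hA.eigenvalues i ≤ θ} : Finset n) :=
    fun i hi => by
      simp only [mem_filter, mem_univ, true_and] at hi ⊢
      exact hi.trans hθ₂
  have hsub₂ : ({i | hA.eigenvalues i ≤ θ} : Finset n) ⊆
      ({i | hA.eigenvalues i < e₃} : Finset n) :=
    fun i hi => by
      simp only [mem_filter, mem_univ, true_and] at hi ⊢
      exact hi.trans_lt hθ₃
  have hc₁ := card_le_card hsub₁
  have hc₂ := card_le_card hsub₂
  have hcardθ : #{i | hA.eigenvalues i ≤ θ} = m := by omega
  have heq : ({i | hA.eigenvalues i ≤ θ} : Finset n) =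
      ({i | hA.eigenvalues i < e₃} : Finset n) :=
    eq_of_subset_of_card_le hsub₂ (by omega)
  refine ⟨hA, sub_nonneg.mpr h₁₂, by linarith, hcardθ, fun i => ?_⟩
  by_cases hi : hA.eigenvalues i ≤ θ
  · exact Or.inl hi
  · right
    have hi' : i ∉ ({i | hA.eigenvalues i < e₃} : Finset n) := by
      rw [← heq]
      simpa using hi
    have hi'' : e₃ ≤ hA.eigenvalues i := by simpa using hi'
    have hE₀le' := hE₀le
    rw [hE₀] at hE₀le'
    linarith

/-- **Cluster gap from block form bounds, symmetric window.** With an `A`-invariant subspace `K`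
of dimension `m ≥ 1`, `|re ⟪x, A x⟫ − E‖x‖²| ≤ δ‖x‖²` on `K` and
`re ⟪x, A x⟫ ≥ (E + g − δ)‖x‖²` on `Kᗮ` with `4δ < g`:
`A.HasClusterGap m (2δ) (g − 4δ)`. This is the shape of Michalakis–Zwolak §7 with
`δ = ‖Δ_s‖`, `g = (1 − cJ)γ` (arXiv:1109.1588 p. 16).
[cite: MichalakisZwolakCMP2013, §7 (arXiv:1109.1588 pp. 15–16)] -/
theorem hasClusterGap_of_invariant_forms' {A : Matrix n n ℂ} (hA : A.IsHermitian)
    (K : Submodule ℂ (EuclideanSpace ℂ n)) (hinv : ∀ x ∈ K, toEuclideanLin A x ∈ K)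
    {m : ℕ} (hm : 0 < m) (hK : finrank ℂ K = m) {E δ g : ℝ} (hδ : 0 ≤ δ) (hg : 4 * δ < g)
    (hlow₁ : ∀ x ∈ K, (E - δ) * ‖x‖ ^ 2 ≤ RCLike.re ⟪x, toEuclideanLin A x⟫_ℂ)
    (hlow₂ : ∀ x ∈ K, RCLike.re ⟪x, toEuclideanLin A x⟫_ℂ ≤ (E + δ) * ‖x‖ ^ 2)
    (hhigh : ∀ x ∈ Kᗮ, (E + g - δ) * ‖x‖ ^ 2 ≤ RCLike.re ⟪x, toEuclideanLin A x⟫_ℂ) :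
    A.HasClusterGap m (2 * δ) (g - 4 * δ) := by
  have h := hasClusterGap_of_invariant_forms hA K hinv hm hK (e₁ := E - δ) (e₂ := E + δ)
    (e₃ := E + g - δ) (by linarith) (by linarith) hlow₁ hlow₂ hhigh
  have h1 : E + δ - (E - δ) = 2 * δ := by ring
  have h2 : E + g - δ - 2 * (E + δ) + (E - δ) = g - 4 * δ := by ring
  rwa [h1, h2] at h

end Complex

end Literature.MathematicalPhysics.QuantumLattice
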